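import Literature.NumberTheory.EllipticCurves.Rank1Residual.X11aPrintCertificates.Claim
import Literature.NumberTheory.EllipticCurves.PAdicLFunctionMultiplicativeInterpolation
import Literature.NumberTheory.EllipticCurves.ModularSymbols
import Literature.NumberTheory.EllipticCurves.CuspFormLFunction
import HarnessLib

/-!
# Class X11a — PRINT-route certificate records: the `μ^an(E,p) = 0` CLAIM of a record carrying a μ-witness

Cell `bsd-print-x11a` (D-0131 (2) print tier), typer seat ty3; barrier B3 (Greenberg's `μ = 0` on
irreducible image) / end-state input (2) of `Summits/…/X11a/EndState.lean`. Companion of `Schema.lean`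
(`Record.mu : List MuWitness`, kernel recheck `Record.checkMu`: a Teichmüller coset
`{a mod pⁿ : a^{p−1} ≡ u^{p−1}}` of `p − 1` residues and plus modular symbols `x⁺{∞, a/pⁿ}` — PARI
`msfromell` normalisation, `x⁺{∞,0} = L(E,1)/Ω_E` — whose sum is a `p`-adic unit) and of the display files
`RecordsLeafN20000.lean` / `RecordsLeafSurjN500000Part*.lean` (two-engine witnesses, eclib ≡ `msfromell`,
for the surjective-leaf classes with `N ≤ 3·10⁴`).

WHAT THE WITNESS MEANS. At a multiplicative prime `p ‖ N` the Mazur–Tate–Teitelbaum measure of `E` is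
`μ_E(a + pⁿℤ_p) = a_p^{−n}·[a/pⁿ]⁺` (MTT 1986 §I.10, `ε(p) = 0`; `a_p = ±1`), so the coset sum of the
record is, up to the unit `a_p^{−n}` and the period-normalisation constant `ϖ` (`ϖ·Ω_E = Ω⁺_f`), the mass
`ν(⟨u⟩(1 + pⁿℤ_p))` of a ball of `Γ = 1 + pℤ_p` for the push-forward `ν` of `μ_E` to `Γ` (trivial tame
character) — and `ν` corresponds to the cyclotomic `p`-adic `L`-function `L_p(E,T) ∈ Λ` under the Iwasawa
isomorphism `Λ = ℤ_p[[T]] ≅ ℤ_p[[Γ]]` (measures on `Γ`), which preserves divisibility by `p`: a ball of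
unit mass forbids `L_p ∈ pΛ`, i.e. `μ(L_p(E,T)) = 0`, i.e. SOME coefficient of `ϖ·L_p` is a `p`-adic unit.
That last sentence is exactly the tree's per-pair certificate shape `X11a.MuAnZeroAt W p`
(`Summits/…/X11a/MuLambdaSplit.lean`), consumed by the surjective-leaf chain of record
`X11a.Chain.forall_bsdp_of_namedFacts_ofLevel_heightFree` (12 named facts ⇒ `BSD(E,p)` per pair).

THIS FILE states `Record.MuClaim` — for a record with `mu ≠ []`, the `MuAnZeroAt` statement for the
record's curve and prime, VERBATIM in the Literature vocabulary the Summits definition is written in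
(`IsNewformOf`, `realPeriodRat`, `plusPeriod`, `IsMultPAdicLFunctionOf f p (−1)`,
`IsSplitMultPAdicLFunctionOf`), so that on the Summits side `r.MuClaim ↔ (r.mu ≠ [] → X11a.MuAnZeroAt
r.curve r.p)` holds by `Iff.rfl` — a `Prop` to be ASSUMED (`(hμ : r.MuClaim)`): the dictionary
"unit coset sum ⇒ unit coefficient" above is the Mahler/Iwasawa-isomorphism step (MTT §I.13; Greenberg
LNM 1716 §4), standard but NOT a tree theorem for the tree's interpolation-style definition of `L_p` —
hence a claim, not a proof. Literature cannot import Summits, so no consumer is given here; the display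
files' `mu` data + this claim are what a Summits-side per-pair record feeds to the chain.

Nothing asserted; no named fact; per pair (E1 currency); nothing here moves a label.

References: B. Mazur, J. Tate, J. Teitelbaum, Invent. Math. 84 (1986) §I.10, §I.13
[MazurTateTeitelbaum1986Invent]; R. Greenberg, LNM 1716 (1999) §4, Conj. 1.11 [GreenbergLNM1716];
R. Greenberg, V. Vatsal, Invent. Math. 142 (2000) p. 2–4 [GreenbergVatsal2000]; tree files
`Summits/…/X11a/{MuLambdaSplit,ChainAnyLevel,EndState}.lean`, `X11aPrintCertificates/Schema.lean`.
-/

set_option autoImplicit false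

noncomputable section

open scoped Classical MatrixGroups ModularForm

open CongruenceSubgroup WeierstrassCurve Literature.NumberTheory.EllipticCurves
  Literature.NumberTheory.EllipticCurves.ModularForms

namespace Literature.NumberTheory.EllipticCurves.Rank1Residual.X11aPrintCertificates

namespace Record

/-- **The `μ^an(E,p) = 0` claim of a record** (`E = r.curve`, `p = r.p`): if the record carries a
μ-witness (`r.mu ≠ []`), then for every newform `f` of `E` and every `ϖ ∈ ℚ` with `ϖ·Ω_E = Ω⁺_f`, SOME
coefficient of the Néron-normalised Mazur–Tate–Teitelbaum series `ϖ·L_p` — THE non-split function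
(`IsMultPAdicLFunctionOf f p (−1)`) at a non-split `p`, THE split one (`IsSplitMultPAdicLFunctionOf`) at a
split `p` — is a `p`-adic unit. VERBATIM the body of `X11a.MuAnZeroAt` (Summits); what the kernel-rechecked
coset sum certifies via MTT §I.10 + the Iwasawa isomorphism (module docstring). A `Prop` to be ASSUMED;
nothing in the tree proves it from the witness. [cite: MazurTateTeitelbaum1986Invent, §I.10 and §I.13]
[cite: GreenbergLNM1716, Conj. 1.11 and §4 (shape only; nothing asserted)] -/
def MuClaim (r : Record) : Prop :=
  ∀ [Fact r.p.Prime] [r.curve.IsElliptic], r.mu ≠ [] →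
    ∀ {N : ℕ} [NeZero N] (f : CuspForm (Gamma0 N) 2), IsNewformOf r.curve f →
      ∀ (ϖ : ℚ), (ϖ : ℝ) * r.curve.realPeriodRat = plusPeriod f →
        (¬ r.curve.HasSplitMultiplicativeReductionAtPrime r.p →
          ∀ L : PowerSeries ℚ_[r.p], IsMultPAdicLFunctionOf f r.p (-1) L →
            ∃ n : ℕ, ‖PowerSeries.coeff n (PowerSeries.C ((ϖ : ℚ) : ℚ_[r.p]) * L)‖ = 1) ∧
        (r.curve.HasSplitMultiplicativeReductionAtPrime r.p →
          ∀ L : PowerSeries ℚ_[r.p], IsSplitMultPAdicLFunctionOf f r.p L →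
            ∃ n : ℕ, ‖PowerSeries.coeff n (PowerSeries.C ((ϖ : ℚ) : ℚ_[r.p]) * L)‖ = 1)

/-- A record WITHOUT a μ-witness claims nothing here (`MuClaim` is vacuous). [cite: GreenbergLNM1716, Conj. 1.11 (shape only)] -/
theorem muClaim_of_mu_eq_nil (r : Record) (h : r.mu = []) : r.MuClaim := by
  intro _ _ hne
  exact absurd h hne

end Record

/-- The μ-claims of a list of records: every record's `MuClaim`. [cite: GreenbergLNM1716, Conj. 1.11 (shape only)] -/
def MuClaims (rs : List Record) : Prop := ∀ r ∈ rs, r.MuClaim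

end Literature.NumberTheory.EllipticCurves.Rank1Residual.X11aPrintCertificates

end
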